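import Summits.ResolutionOfSingularities.ResolutionOfSingularities.Theorems.FrobeniusClosingSteerRadicandQuotients
import Literature.AlgebraicGeometry.Resolution.PthRootDerivationRegular
import Literature.AlgebraicGeometry.Resolution.RegularLocalRingsJacobian
import Literature.AlgebraicGeometry.Resolution.RegularLocalRingsQuotient
import Literature.AlgebraicGeometry.Resolution.FlatLocalRegularAscent
import HarnessLib

/-!
# Crux `Steer` (stmt-ResolutionOfSingularities-16345), chain W4.1: the SINGULARITY CRITERION for `p`-radicand germs
# and EMPTY STALLS at `p = 2` (λ1 / M helper, Theses-free)

OURS (campaign `res-hironaka`, rung L ★L-G4, slot W4.1; replaces the role of no printed item; NOT a statement of the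
manuscript under review [claim: Hironaka2017, status: under-review]; AI review is weaker than expert review).
ORDER of res-L0-w41-plan-1 (HOME/STATUS 2026-08-27T05:02:14Z) on its NOTE 04:59:19Z (F1)/(F2); seat res-type-082.

For a REGULAR LOCAL ring `(S, 𝔪, κ)` of prime characteristic `p` and a radicand `f ∈ S`, the torsor germ
`S[T]/(T^p − f)` (`AdjoinRoot (X ^ p - C f)`, the `RadicandRing` of the W4.1 sketches) is a LOCAL ring (tree:
`isLocalRing_adjoinRoot_X_pow_sub_C_of_charP`), and

  **`S[T]/(T^p − f)` is NOT regular  ⟺  `f − g^p ∈ 𝔪²` for some `g ∈ S`**   (`not_isRegularLocalRing_adjoinRoot_iff`).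

No hypothesis on the residue field is needed. Proof. (i) If `f̄ ∉ κ^p` then `T^p − f̄` is irreducible over `κ`
(Kummer), so the closed fibre `κ[T]/(T^p − f̄)` is a field, `𝔪·S[T]/(T^p−f)` is the maximal ideal, and regularity ASCENDS
along the finite free local extension `S → S[T]/(T^p − f)` (Matsumura 23.7 (ii), tree
`IsRegularLocalRing.of_flat_of_map_maximalIdeal_eq`); and no `g` has `f − g^p ∈ 𝔪`. (ii) If `f − g₀^p ∈ 𝔪` for some `g₀`,
the substitution `T ↦ T + g₀` identifies `S[T]/(T^p − f)` with `S[U]/(U^p − a)`, `a := f − g₀^p ∈ 𝔪` (characteristic `p`),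
and `f − g^p ∈ 𝔪²` for some `g` iff `a ∈ 𝔪²` (`(g − g₀)^p ∈ 𝔪^p ⊆ 𝔪²`). For `a ∈ 𝔪` the ring `B := S[U]/(U^p − a)`
is local with maximal ideal `𝔑 = 𝔪B + (u)` (tree `AdjoinRoot.isLocalRing_and_maximalIdeal_eq`), `B/(u) ≅ S/(a)`
(`nonempty_quotRootEquiv`), `u ∉ 𝔑²` (probe `B → κ[ε]`, `u ↦ ε`: `𝔑 ↦ (ε)`, `(ε)² = 0`, `ε ≠ 0`), and for `a ≠ 0` the element
`u` is a non-zero-divisor (`u^p = a` acts injectively on the free `S`-module `B`). Hence, by Matsumura 14.2 / 19.2 in the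
tree (`IsRegularLocalRing.quotient_span_singleton`, `…of_quotient_span_singleton`,
`not_isRegularLocalRing_quotient_span_singleton_of_mem_sq`): `B` regular ⟺ `S/(a)` regular ⟺ `a ∉ 𝔪²`; and for
`a = 0` the ring `B = S[U]/(U^p)` is not reduced, so not regular, while `0 ∈ 𝔪²`.

## What is proved (namespace `…Theorems.SwitchingDichotomy.RadicandSingular`; the glue `nonempty_quotRootEquiv`,
## `nonempty_shiftEquiv`, `root_not_mem_sq`, `charP_adjoinRoot` is part 1, `FrobeniusClosingSteerRadicandQuotients.lean`)
* `isRegularLocalRing_adjoinRoot_of_not_mem_sq` / `not_isRegularLocalRing_adjoinRoot_of_mem_sq` — the two halves at a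
  radicand `a ∈ 𝔪`; `isRegularLocalRing_adjoinRoot_of_forall_sub_pow_not_mem` — the unramified case.
* **(a)** `isRegularLocalRing_adjoinRoot_iff` / `not_isRegularLocalRing_adjoinRoot_iff` — the criterion.
* **(b)** `not_isRegularLocalRing_adjoinRoot_atPrime_iff` — the same over `Localization.AtPrime Q` (= the W4.1 sketch's
  `IsSingPrime R p f Q` UNFOLDED: `¬ IsRegularLocalRing (AdjoinRoot (X ^ p - C (algebraMap R (Localization.AtPrime Q) f)))`).
* **(c)** `not_singular_of_forall_sub_pow_not_mem_sq` and `not_steeredStallAt_two` — a «steered STALL» is EMPTY at `p = 2`: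
  «singular at `𝔪`» ∧ «`∀ g, f − g^2 ∉ 𝔪^2`» is contradictory for a regular member (the W4.1 sketch's
  `SteeredStallAt R 2 s N`, L/w41/Sketch-R2-steered.lean §3.2, UNFOLDED at its first and third clause; the torsor over
  `Localization.AtPrime (maximalIdeal S) ≅ S`).

Consumers (per the ORDER): stub-8's exit/stall trichotomy certificates, the `p = 2` σ-line's B₂ (CHAIN v5.4a), the
K4.1d/K4.1f engines' singularity certificates. No Theses file is imported; nothing here is a route item or a
registration. [cite: Matsumura1987, Thm. 14.2, Thm. 19.2, Thm. 23.7] [cite: StacksProject, Tag 07PG]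
-/

noncomputable section

-- `Summit.<S>.<S>.…` duplicates the summit name by design (single-problem summit).
set_option linter.dupNamespace false

open Polynomial IsLocalRing

namespace Summit.ResolutionOfSingularities.ResolutionOfSingularities.Theorems.SwitchingDichotomy.RadicandSingular

open Literature.AlgebraicGeometry.Resolution

universe u v
/-! ## §3 Over a REGULAR LOCAL ring of characteristic `p`: the criterion -/

section Regular

variable {S : Type u} [CommRing S] [IsRegularLocalRing S] (p : ℕ) [Fact p.Prime] [CharP S p]

omit [CharP S p] in
/-- **Radicand `a ∈ 𝔪 ∖ 𝔪²` ⇒ `S[U]/(U^p − a)` is a regular local ring** (any characteristic): `B = S[U]/(U^p − a)` is local Noetherian,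
`u ∈ 𝔑` is a non-zero-divisor (`u^p = a ≠ 0` acts injectively on the free `S`-module `B`) and `B/(u) ≅ S/(a)` is regular
(Matsumura 14.2), so `B` is regular (Matsumura 19.2, tree `IsRegularLocalRing.of_quotient_span_singleton`).
[cite: Matsumura1987, Thm. 14.2, Thm. 19.2] -/
theorem isRegularLocalRing_adjoinRoot_of_not_mem_sq {a : S} (ha : a ∈ maximalIdeal S)
    (ha2 : a ∉ maximalIdeal S ^ 2) : IsRegularLocalRing (AdjoinRoot (X ^ p - C a : S[X])) := by
  have hp0 : 0 < p := (Fact.out : p.Prime).pos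
  have hmon : (X ^ p - C a : S[X]).Monic := monic_X_pow_sub_C a (Fact.out : p.Prime).ne_zero
  haveI : Module.Finite S (AdjoinRoot (X ^ p - C a : S[X])) := hmon.finite_adjoinRoot
  haveI : Module.Free S (AdjoinRoot (X ^ p - C a : S[X])) := hmon.free_adjoinRoot
  haveI : IsNoetherianRing (AdjoinRoot (X ^ p - C a : S[X])) := inferInstance
  haveI : IsDomain S := isDomain_of_isRegularLocalRing S
  obtain ⟨hloc, hmax⟩ := AdjoinRoot.isLocalRing_and_maximalIdeal_eq (y := a) hp0 ha
  haveI := hloc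
  have ha0 : a ≠ 0 := fun h => ha2 (h ▸ Ideal.zero_mem _)
  -- `u ∈ 𝔑`
  have hroot : AdjoinRoot.root (X ^ p - C a : S[X]) ∈ maximalIdeal (AdjoinRoot (X ^ p - C a : S[X])) := by
    rw [hmax]; exact Ideal.mem_sup_right (Ideal.subset_span rfl)
  -- `u` is a non-zero-divisor: `u^p = a` is one on the free `S`-module `B`
  have hreg : IsSMulRegular (AdjoinRoot (X ^ p - C a : S[X])) (AdjoinRoot.root (X ^ p - C a : S[X])) := by
    have ha' : IsSMulRegular (AdjoinRoot (X ^ p - C a : S[X]))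
        (algebraMap S (AdjoinRoot (X ^ p - C a : S[X])) a) :=
      ((IsRegular.of_ne_zero ha0).left.isSMulRegular).of_flat
    rw [AdjoinRoot.algebraMap_eq, ← root_pow_eq_of] at ha'
    exact (IsSMulRegular.pow_iff hp0).mp ha'
  -- `B/(u) ≅ S/(a)` is regular
  obtain ⟨e⟩ := nonempty_quotRootEquiv a hp0
  haveI : IsRegularLocalRing
      (AdjoinRoot (X ^ p - C a : S[X]) ⧸ Ideal.span {AdjoinRoot.root (X ^ p - C a : S[X])}) :=
    haveI := (IsRegularLocalRing.quotient_span_singleton ha ha2).1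
    IsRegularLocalRing.of_ringEquiv e.symm
  exact IsRegularLocalRing.of_quotient_span_singleton hroot hreg

omit [CharP S p] in
/-- **Radicand `a ∈ 𝔪²` ⇒ `S[U]/(U^p − a)` is NOT regular** (any characteristic): for `a = 0` the ring `S[U]/(U^p)` is not reduced (a
regular local ring is a domain); for `a ≠ 0`, if `B` were regular then, as `u ∉ 𝔑²` (`root_not_mem_sq`), `B/(u) ≅ S/(a)`
would be regular (Matsumura 14.2), which it is not for `0 ≠ a ∈ 𝔪²` (tree
`not_isRegularLocalRing_quotient_span_singleton_of_mem_sq`). [cite: Matsumura1987, Thm. 14.2, Thm. 14.3] -/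
theorem not_isRegularLocalRing_adjoinRoot_of_mem_sq {a : S} (ha2 : a ∈ maximalIdeal S ^ 2) :
    ¬ IsRegularLocalRing (AdjoinRoot (X ^ p - C a : S[X])) := by
  have hp0 : 0 < p := (Fact.out : p.Prime).pos
  have ha : a ∈ maximalIdeal S := Ideal.pow_le_self two_ne_zero ha2
  haveI : IsDomain S := isDomain_of_isRegularLocalRing S
  intro hreg
  haveI := hreg
  haveI : IsDomain (AdjoinRoot (X ^ p - C a : S[X])) := isDomain_of_isRegularLocalRing _
  by_cases ha0 : a = 0
  · -- `u^p = 0`, `u ≠ 0`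
    subst ha0
    have hu : AdjoinRoot.root (X ^ p - C (0 : S) : S[X]) = 0 := by
      have h : AdjoinRoot.root (X ^ p - C (0 : S) : S[X]) ^ p = 0 := by
        rw [root_pow_eq_of]; exact map_zero (AdjoinRoot.of _)
      exact (pow_eq_zero_iff (Fact.out : p.Prime).ne_zero).mp h
    have hdvd : (X ^ p - C (0 : S) : S[X]) ∣ X := by
      rw [← AdjoinRoot.mk_eq_zero, AdjoinRoot.mk_X]; exact hu
    have hdeg := Polynomial.degree_le_of_dvd hdvd X_ne_zero
    rw [map_zero, sub_zero, degree_X_pow, degree_X] at hdeg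
    have h1 : p ≤ 1 := by exact_mod_cast hdeg
    have hp2 := (Fact.out : p.Prime).two_le
    omega
  · have hroot : AdjoinRoot.root (X ^ p - C a : S[X]) ∈ maximalIdeal (AdjoinRoot (X ^ p - C a : S[X])) := by
      obtain ⟨_, hmax⟩ := AdjoinRoot.isLocalRing_and_maximalIdeal_eq (y := a) hp0 ha
      rw [hmax]; exact Ideal.mem_sup_right (Ideal.subset_span rfl)
    have hroot2 := root_not_mem_sq (Fact.out : p.Prime).two_le ha
    haveI := (IsRegularLocalRing.quotient_span_singleton hroot hroot2).1
    obtain ⟨e⟩ := nonempty_quotRootEquiv a hp0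
    have h2 : IsRegularLocalRing (S ⧸ Ideal.span ({a} : Set S)) := IsRegularLocalRing.of_ringEquiv e
    exact not_isRegularLocalRing_quotient_span_singleton_of_mem_sq ha0 ha2 h2

/-- **Unramified radicand ⇒ regular**: if `f − g^p ∉ 𝔪` for every `g` (i.e. `f̄ ∉ κ^p`), then `S[T]/(T^p − f)` is a
regular local ring: `T^p − f̄` is irreducible over `κ` (Kummer), so `𝔪·S[T]/(T^p − f)` is maximal, equal to the maximal
ideal of the local ring `S[T]/(T^p − f)` (tree `isLocalRing_adjoinRoot_X_pow_sub_C_of_charP`), and regularity ascends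
along the flat local map `S → S[T]/(T^p − f)` with trivial closed fibre (Matsumura 23.7 (ii), tree
`IsRegularLocalRing.of_flat_of_map_maximalIdeal_eq`). [cite: Matsumura1987, Thm. 23.7] -/
theorem isRegularLocalRing_adjoinRoot_of_forall_sub_pow_not_mem {f : S}
    (hf : ∀ g : S, f - g ^ p ∉ maximalIdeal S) : IsRegularLocalRing (AdjoinRoot (X ^ p - C f : S[X])) := by
  have hmon : (X ^ p - C f : S[X]).Monic := monic_X_pow_sub_C f (Fact.out : p.Prime).ne_zero
  haveI : Module.Finite S (AdjoinRoot (X ^ p - C f : S[X])) := hmon.finite_adjoinRoot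
  haveI : Module.Free S (AdjoinRoot (X ^ p - C f : S[X])) := hmon.free_adjoinRoot
  haveI : Algebra.IsIntegral S (AdjoinRoot (X ^ p - C f : S[X])) := inferInstance
  haveI : IsNoetherianRing (AdjoinRoot (X ^ p - C f : S[X])) := inferInstance
  haveI : IsLocalRing (AdjoinRoot (X ^ p - C f : S[X])) := isLocalRing_adjoinRoot_X_pow_sub_C_of_charP p f
  -- the structure map is local: the maximal ideal lies over `𝔪`
  have hcomap : (maximalIdeal (AdjoinRoot (X ^ p - C f : S[X]))).comap
      (algebraMap S (AdjoinRoot (X ^ p - C f : S[X]))) = maximalIdeal S := by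
    haveI : ((maximalIdeal (AdjoinRoot (X ^ p - C f : S[X]))).comap
        (algebraMap S (AdjoinRoot (X ^ p - C f : S[X])))).IsMaximal :=
      Ideal.isMaximal_comap_of_isIntegral_of_isMaximal _
    exact IsLocalRing.eq_maximalIdeal inferInstance
  haveI : IsLocalHom (algebraMap S (AdjoinRoot (X ^ p - C f : S[X]))) := by
    refine ⟨fun s hs => ?_⟩
    by_contra hns
    have h1 : s ∈ (maximalIdeal (AdjoinRoot (X ^ p - C f : S[X]))).comap
        (algebraMap S (AdjoinRoot (X ^ p - C f : S[X]))) :=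
      hcomap ▸ (mem_maximalIdeal _).mpr hns
    exact (mem_maximalIdeal _).mp (Ideal.mem_comap.mp h1) hs
  -- the closed fibre is a field
  have hirr : Irreducible (X ^ p - C (residue S f) : (ResidueField S)[X]) := by
    refine X_pow_sub_C_irreducible_of_prime (Fact.out : p.Prime) fun b hb => ?_
    obtain ⟨g, hg⟩ := Ideal.Quotient.mk_surjective b
    have hb' : residue S g ^ p = residue S f := by rw [← hb, ← hg]; rfl
    refine hf g ?_
    rw [← residue_eq_zero_iff, map_sub, map_pow, ← hb', sub_self]
  have hmapq : (X ^ p - C f : S[X]).map (Ideal.Quotient.mk (maximalIdeal S)) =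
      X ^ p - C (Ideal.Quotient.mk (maximalIdeal S) f) := by
    rw [Polynomial.map_sub, Polynomial.map_pow, map_X, map_C]
  have hfield : IsField (AdjoinRoot (X ^ p - C f : S[X]) ⧸
      (maximalIdeal S).map (AdjoinRoot.of (X ^ p - C f : S[X]))) := by
    haveI : Fact (Irreducible (X ^ p - C (residue S f) : (ResidueField S)[X])) := ⟨hirr⟩
    have hF : IsField (AdjoinRoot (X ^ p - C (residue S f) : (ResidueField S)[X])) := Field.toIsField _
    have hspan : Ideal.span {(X ^ p - C f : S[X]).map (Ideal.Quotient.mk (maximalIdeal S))} =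
        Ideal.span {(X ^ p - C (Ideal.Quotient.mk (maximalIdeal S) f) : (S ⧸ maximalIdeal S)[X])} := by
      rw [hmapq]
    exact MulEquiv.isField hF
      (((AdjoinRoot.quotEquivQuotMap (X ^ p - C f : S[X]) (maximalIdeal S)).toRingEquiv.trans
        (Ideal.quotEquivOfEq hspan)).toMulEquiv)
  have hmaxmap : ((maximalIdeal S).map (algebraMap S (AdjoinRoot (X ^ p - C f : S[X])))).IsMaximal := by
    rw [AdjoinRoot.algebraMap_eq]
    exact Ideal.Quotient.maximal_of_isField _ hfield
  have h : (maximalIdeal S).map (algebraMap S (AdjoinRoot (X ^ p - C f : S[X]))) =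
      maximalIdeal (AdjoinRoot (X ^ p - C f : S[X])) :=
    IsLocalRing.eq_maximalIdeal hmaxmap
  exact IsRegularLocalRing.of_flat_of_map_maximalIdeal_eq S (AdjoinRoot (X ^ p - C f : S[X])) h

/-- **(a) The regularity criterion for `p`-radicand germs.** For a regular local ring `S` of prime characteristic `p`
and `f ∈ S`: `S[T]/(T^p − f)` is a regular local ring iff `f − g^p ∉ 𝔪²` for EVERY `g ∈ S`. (No hypothesis on the residue
field.) [cite: Matsumura1987, Thm. 14.2, Thm. 19.2, Thm. 23.7] -/
theorem isRegularLocalRing_adjoinRoot_iff (f : S) :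
    IsRegularLocalRing (AdjoinRoot (X ^ p - C f : S[X])) ↔ ∀ g : S, f - g ^ p ∉ maximalIdeal S ^ 2 := by
  haveI : IsDomain S := isDomain_of_isRegularLocalRing S
  have hp2 := (Fact.out : p.Prime).two_le
  by_cases h : ∃ g₀ : S, f - g₀ ^ p ∈ maximalIdeal S
  · obtain ⟨g₀, hg₀⟩ := h
    obtain ⟨e⟩ := nonempty_shiftEquiv (p := p) f g₀
    -- `∃ g, f − g^p ∈ 𝔪²` iff `f − g₀^p ∈ 𝔪²`
    have key : (∀ g : S, f - g ^ p ∉ maximalIdeal S ^ 2) ↔ f - g₀ ^ p ∉ maximalIdeal S ^ 2 := by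
      constructor
      · exact fun hall => hall g₀
      · intro ha2 g hg
        apply ha2
        have hsplit : f - g₀ ^ p = (f - g ^ p) + (g - g₀) ^ p := by
          rw [sub_pow_char]; ring
        have hgg : (g - g₀) ^ p ∈ maximalIdeal S := by
          have : (g - g₀) ^ p = (f - g₀ ^ p) - (f - g ^ p) := by rw [hsplit]; ring
          rw [this]
          exact Ideal.sub_mem _ hg₀ (Ideal.pow_le_self two_ne_zero hg)
        have hgg' : g - g₀ ∈ maximalIdeal S := Ideal.IsPrime.mem_of_pow_mem inferInstance p hgg
        rw [hsplit]
        exact Ideal.add_mem _ hg (Ideal.pow_le_pow_right hp2 (Ideal.pow_mem_pow hgg' p))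
    rw [key]
    constructor
    · intro hreg ha2
      haveI := hreg
      exact not_isRegularLocalRing_adjoinRoot_of_mem_sq p ha2 (IsRegularLocalRing.of_ringEquiv e)
    · intro ha2
      haveI := isRegularLocalRing_adjoinRoot_of_not_mem_sq p hg₀ ha2
      exact IsRegularLocalRing.of_ringEquiv e.symm
  · push Not at h
    refine ⟨fun _ g hg => h g (Ideal.pow_le_self two_ne_zero hg), fun _ => ?_⟩
    exact isRegularLocalRing_adjoinRoot_of_forall_sub_pow_not_mem p h

/-- **(a′) The SINGULARITY criterion** (ORDER (a) of res-L0-w41-plan-1, HOME/STATUS 2026-08-27T05:02:14Z; its NOTE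
04:59:19Z (F1)): for a regular local ring `S` of prime characteristic `p` and `f ∈ S`, the torsor germ `S[T]/(T^p − f)` is
NOT regular iff `f − g^p ∈ 𝔪²` for SOME `g ∈ S`. [cite: Matsumura1987, Thm. 14.2, Thm. 19.2, Thm. 23.7] -/
theorem not_isRegularLocalRing_adjoinRoot_iff (f : S) :
    ¬ IsRegularLocalRing (AdjoinRoot (X ^ p - C f : S[X])) ↔ ∃ g : S, f - g ^ p ∈ maximalIdeal S ^ 2 := by
  rw [isRegularLocalRing_adjoinRoot_iff p f]
  push Not
  rfl

end Regular

/-! ## §4 At a prime of the base (`IsSingPrime` unfolded) and at the closed point (steered stalls) -/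

section AtPrime

/-- **(b) The criterion at a prime `Q`** (ORDER (b); the W4.1 sketch's `IsSingPrime R p f Q :=
¬ IsRegularLocalRing (RadicandRing (Localization.AtPrime Q) p (algebraMap R _ f))` UNFOLDED, `RadicandRing S p f =
AdjoinRoot (X ^ p - C f)`): if the local ring `R_Q` is regular of characteristic `p`, the torsor `T^p = f` is singular over
`Q` iff `f − g^p ∈ (Q R_Q)²` for some `g ∈ R_Q`. [cite: Matsumura1987, Thm. 14.2] -/
theorem not_isRegularLocalRing_adjoinRoot_atPrime_iff {R : Type v} [CommRing R] (p : ℕ) [Fact p.Prime]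
    (Q : Ideal R) [Q.IsPrime] [IsRegularLocalRing (Localization.AtPrime Q)] [CharP (Localization.AtPrime Q) p]
    (f : R) :
    ¬ IsRegularLocalRing (AdjoinRoot
        (X ^ p - C (algebraMap R (Localization.AtPrime Q) f) : (Localization.AtPrime Q)[X])) ↔
      ∃ g : Localization.AtPrime Q,
        algebraMap R (Localization.AtPrime Q) f - g ^ p ∈ maximalIdeal (Localization.AtPrime Q) ^ 2 :=
  not_isRegularLocalRing_adjoinRoot_iff p _

end AtPrime

section Stall

variable {S : Type u} [CommRing S] [IsRegularLocalRing S] (p : ℕ) [Fact p.Prime] [CharP S p]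

omit [Fact p.Prime] in
/-- The localisation of a regular local ring of characteristic `p` at its maximal ideal has characteristic `p` (the
localisation map of a domain is injective). [folklore] -/
theorem charP_localization_maximalIdeal : CharP (Localization.AtPrime (maximalIdeal S)) p := by
  haveI : IsDomain S := isDomain_of_isRegularLocalRing S
  exact charP_of_injective_algebraMap
    (IsLocalization.injective (Localization.AtPrime (maximalIdeal S))
      (Ideal.primeCompl_le_nonZeroDivisors (maximalIdeal S))) p

/-- **(c) Singular at the closed point forces `f − g^p ∈ 𝔪²` for some `g`** — the torsor read over
`Localization.AtPrime (maximalIdeal S) ≅ S` as in the W4.1 sketch's `IsSingPrime (R N) p f (maximalIdeal (R N))`: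
for a regular local `S` of characteristic `p`, «`T^p = f` singular at `𝔪`» and «`f − g^p ∉ 𝔪²` for all `g`» are
contradictory. [cite: Matsumura1987, Thm. 14.2] -/
theorem not_singular_of_forall_sub_pow_not_mem_sq (f : S)
    (hsing : ¬ IsRegularLocalRing (AdjoinRoot (X ^ p -
        C (algebraMap S (Localization.AtPrime (maximalIdeal S)) f) : (Localization.AtPrime (maximalIdeal S))[X])))
    (hclean : ∀ g : S, f - g ^ p ∉ maximalIdeal S ^ 2) : False := by
  haveI : IsRegularLocalRing (Localization.AtPrime (maximalIdeal S)) :=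
    isRegularLocalRing_localization_atPrime S (maximalIdeal S)
  haveI : CharP (Localization.AtPrime (maximalIdeal S)) p := charP_localization_maximalIdeal (S := S) p
  obtain ⟨g', hg'⟩ := (not_isRegularLocalRing_adjoinRoot_iff p
    (algebraMap S (Localization.AtPrime (maximalIdeal S)) f)).mp hsing
  -- `S ≃ S_𝔪`: pull `g'` back
  let e : S ≃ₐ[S] Localization.AtPrime (maximalIdeal S) :=
    IsLocalization.atUnits S (maximalIdeal S).primeCompl
      (fun x hx => of_not_not fun hnu => hx ((IsLocalRing.mem_maximalIdeal x).mpr hnu))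
  obtain ⟨g, rfl⟩ := e.surjective g'
  refine hclean g ?_
  have hef : e.toRingEquiv f = algebraMap S (Localization.AtPrime (maximalIdeal S)) f := by
    have := e.commutes f
    simpa using this
  have hmem : e.toRingEquiv (f - g ^ p) ∈ (maximalIdeal S ^ 2).map e.toRingEquiv := by
    rw [Ideal.map_pow, map_ringEquiv_maximalIdeal, map_sub, map_pow, hef]
    exact hg'
  exact Ideal.apply_mem_of_equiv_iff.mp hmem

/-- **(c′) EMPTY STEERED STALLS AT `p = 2`** (ORDER (c); res-L0-w41-plan-1 NOTE 2026-08-27T04:59:19Z (F2); the W4.1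
sketch's `SteeredStallAt R 2 s N`, L/w41/Sketch-R2-steered.lean §3.2, UNFOLDED at its first clause «singular at `𝔪`»
and third clause «`∀ g, f − g ^ 2 ∉ 𝔪 ^ 2`» for the regular member `S = R N` and `f = (s N)²`): contradictory. So the
`p = 2` σ-line needs no oracle at a stall — there is none. [cite: Matsumura1987, Thm. 14.2] -/
theorem not_steeredStallAt_two [Fact (2 : ℕ).Prime] [CharP S 2] (f : S)
    (hsing : ¬ IsRegularLocalRing (AdjoinRoot (X ^ 2 -
        C (algebraMap S (Localization.AtPrime (maximalIdeal S)) f) : (Localization.AtPrime (maximalIdeal S))[X])))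
    (hclean : ∀ g : S, f - g ^ 2 ∉ maximalIdeal S ^ 2) : False :=
  not_singular_of_forall_sub_pow_not_mem_sq (S := S) 2 f hsing hclean

end Stall

/-! ## §5 (append-only rev 2) The criterion at the CLOSED POINT with witnesses in `S` itself -/

section ClosedPoint

variable {S : Type u} [CommRing S] [IsRegularLocalRing S] (p : ℕ) [Fact p.Prime] [CharP S p]

/-- **(b′) The singularity criterion at the closed point, witnesses pulled back to `S`** (the W4.1 sketch's
`IsSingPrime S p f (maximalIdeal S)` UNFOLDED — the torsor over `Localization.AtPrime (maximalIdeal S) ≅ S` — for the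
closed-point dictionary of res-L0-w41-stub-2, HOME/STATUS 2026-08-27T05:47:27Z (i)/(iii)): for a regular local `S` of
characteristic `p` and `f ∈ S`, «`T^p = f` is singular at `𝔪`» iff `f − g^p ∈ 𝔪²` for some `g ∈ S` (not merely some
`g ∈ S_𝔪`). Transport along `IsLocalization.atUnits`. [cite: Matsumura1987, Thm. 14.2] -/
theorem not_isRegularLocalRing_adjoinRoot_atMaximalIdeal_iff (f : S) :
    ¬ IsRegularLocalRing (AdjoinRoot (X ^ p -
        C (algebraMap S (Localization.AtPrime (maximalIdeal S)) f) : (Localization.AtPrime (maximalIdeal S))[X])) ↔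
      ∃ g : S, f - g ^ p ∈ maximalIdeal S ^ 2 := by
  haveI : IsRegularLocalRing (Localization.AtPrime (maximalIdeal S)) :=
    isRegularLocalRing_localization_atPrime S (maximalIdeal S)
  haveI : CharP (Localization.AtPrime (maximalIdeal S)) p := charP_localization_maximalIdeal (S := S) p
  let e : S ≃ₐ[S] Localization.AtPrime (maximalIdeal S) :=
    IsLocalization.atUnits S (maximalIdeal S).primeCompl
      (fun x hx => of_not_not fun hnu => hx ((IsLocalRing.mem_maximalIdeal x).mpr hnu))
  have hef : e.toRingEquiv f = algebraMap S (Localization.AtPrime (maximalIdeal S)) f := by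
    have := e.commutes f
    simpa using this
  have hmap : (maximalIdeal S ^ 2).map e.toRingEquiv = maximalIdeal (Localization.AtPrime (maximalIdeal S)) ^ 2 := by
    rw [Ideal.map_pow, map_ringEquiv_maximalIdeal]
  rw [not_isRegularLocalRing_adjoinRoot_iff p (algebraMap S (Localization.AtPrime (maximalIdeal S)) f)]
  constructor
  · rintro ⟨g', hg'⟩
    obtain ⟨g, rfl⟩ := e.surjective g'
    refine ⟨g, ?_⟩
    have hmem : e.toRingEquiv (f - g ^ p) ∈ (maximalIdeal S ^ 2).map e.toRingEquiv := by
      rw [hmap, map_sub, map_pow, hef]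
      exact hg'
    exact Ideal.apply_mem_of_equiv_iff.mp hmem
  · rintro ⟨g, hg⟩
    refine ⟨e g, ?_⟩
    have hmem : e.toRingEquiv (f - g ^ p) ∈ (maximalIdeal S ^ 2).map e.toRingEquiv :=
      Ideal.apply_mem_of_equiv_iff.mpr hg
    rw [hmap, map_sub, map_pow, hef] at hmem
    exact hmem

/-- **(b″) `p = 2` reading for the σ-line**: at `p = 2` the stall clause «`∀ g, f − g^p ∉ 𝔪^p`» of the W4.1 sketch's
`SteeredStallAt` is LITERALLY the negation of the right-hand side of (b′), so «singular at `𝔪`» ⟺ «some cleaning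
`f − g² ∈ 𝔪²`» ⟺ «not every cleaning stays outside `𝔪^p`» — the closed-point dictionary entry behind
`not_steeredStallAt_two`. [cite: Matsumura1987, Thm. 14.2] -/
theorem not_isRegularLocalRing_adjoinRoot_atMaximalIdeal_iff_two [Fact (2 : ℕ).Prime] [CharP S 2] (f : S) :
    ¬ IsRegularLocalRing (AdjoinRoot (X ^ 2 -
        C (algebraMap S (Localization.AtPrime (maximalIdeal S)) f) : (Localization.AtPrime (maximalIdeal S))[X])) ↔
      ¬ ∀ g : S, f - g ^ 2 ∉ maximalIdeal S ^ 2 := by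
  rw [not_isRegularLocalRing_adjoinRoot_atMaximalIdeal_iff (S := S) 2 f]
  push Not
  rfl

end ClosedPoint

end Summit.ResolutionOfSingularities.ResolutionOfSingularities.Theorems.SwitchingDichotomy.RadicandSingular

end
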